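import Summits.ResolutionOfSingularities.ResolutionOfSingularities.Theorems.PurelyInseparableDim4ChartAtlasReading
import Summits.ResolutionOfSingularities.ResolutionOfSingularities.Theorems.PurelyInseparableDim4ChartCover
import Literature.AlgebraicGeometry.Resolution.RegularSystemOfParameters
import Literature.AlgebraicGeometry.Resolution.BlowupRestrictOpen
import Literature.AlgebraicGeometry.Hironaka2017.Lib.SpecOrders
import HarnessLib

/-!
# Purely inseparable four-folds `z^p + F(x₁, …, x₄)`: an SNC OBSTRUCTION for escaping global centres at depth ≥ 3 —
# two old boundary members through the centre, one of them SHEARED on the other chart, are not simultaneously normal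
# crossings with the centre (brick S3-N2, located negative; cell `res-dim4-pi`, typ-2 g5)

[OURS · counted 0 · a NEGATIVE about OUR S3 (c) strategy «blow up the closure of the escaping chart centre», NOT a statement
about resolution of singularities] (D-0157 DOOR 2; DR-157-C; desk WORD #115 (a) (S3-N2) «depth ≥ 3: the shape of the OLD
boundary members at the added points»; typ-3 g4 K-20a «packages against `M.boundary = E`»). The S3-N1 atlas (E1–E7, typ-2
g5) reads the global centre `Zc` of an escaping next centre on the chart `x_l` (`l ∈ S ∖ S'`) as a coordinate subspace
`V(z, x_T)` AFTER A SHEAR `xᵢ ↦ xᵢ + bᵢ x_j` (`i ∈ S ∖ {j, l}`). An OLD boundary member `{x_m = 0}` containing the blown-up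
centre (`m ∈ S`) has strict transform `{x'_m = 0}` on the `x_l`-chart, which the shear reads as `{x_m + b_m x_j = 0}`; an old
member `{x_j = 0}` reads `{x_j = 0}` (its strict transform on the `x_j`-chart is EMPTY — the local walk at `b` never sees it).
PROVED here (no `sorry`, no new axiom):

* **`not_hasSNCWith_of_shear_hyperplanes`** — on `𝔸⁵_K`: for `m ∈ T`, `j ∉ T`, `b ≠ 0` and ANY list `E` of ideal sheaves
  containing `x_j · 𝒪` and `(x_m + b·x_j) · 𝒪`, **`¬ HasSNCWith E 𝓘Λ_T`** (`𝓘Λ_T = 𝓘(V(z, x_T))`). At the generic point of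
  `Σ = V(z, x_T, x_j)` (a non-empty hyperplane section of the centre): if `u` were a regular system of parameters with
  `x_j·𝒪 = (u_a)`, `(x_m + b x_j)·𝒪 = (u_c)` (`a ≠ c`) and `(z, x_T)·𝒪 = (u_S)`, then `c ∉ S` (else `x_j ∈ (z, x_T)`, contracting
  to `K[z, x]`), and `u_c = w·(x_m + b x_j) ∈ (u_S) + (u_a)` with `c ∉ S ∪ {a}` — impossible for a minimal basis of `𝔪`
  (Matsumura 14.2, tree `not_mem_span_image_of_not_mem`);
* **`not_hasSNCWith_of_chart_readings`** — the `W`-level corollary: for ANY scheme `W`, open immersion `φ : 𝔸⁵_K → W`,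
  centre `Zc` reading `𝓘Λ_T` on `φ` and boundary `E` with two members reading `x_j·𝒪` and `(x_m + b x_j)·𝒪` on `φ`:
  `¬ HasSNCWith E Zc` — `Zc` is NOT an admissible BGMW centre for `(W, ·, E, ·)`;
* §4 (appended) **`not_hasSNCWith_of_two_shear_hyperplanes`**, **`not_hasSNCWith_of_chart_readings_two_shear`** — the TWIN
  obstruction: two SHEARED old members `(x_m + b x_j)·𝒪`, `(x_{m'} + b' x_j)·𝒪` (`m ≠ m' ∈ T`, `b, b' ≠ 0`) obstruct as well.

CONSEQUENCE (S3-N2, located): whenever the current boundary contains two OLD members `D_j = {x_j = 0}`, `D_m = {x_m = 0}`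
through the blown-up centre (`j, m ∈ S`) and the next (escaping) centre read at `b` on the `x_j`-chart contains `m` with
`b_m ≠ 0`, the closure `Zc` FAILS BGMW admissibility (2) against the accumulated boundary, for `j ∉ S'` (`T = S'`) and for
`j ∈ S'` (`T = insert l (S' ∖ {j})`) alike; with ONE such old member the crossing is still transversal — it is the PAIR that
obstructs. HONEST SCOPE: a statement about the chart MODEL and any `W` carrying such readings; whether MODE-1h walks REACH such
configurations is not shown here; nothing is claimed about other global centres realising the same local move; resolution of
singularities in dimension ≥ 4 / characteristic `p` is neither proved nor refuted by anything here. bears_on: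
LADDER-RESOLUTION:D157-DOOR2 (res-dim4-pi). Supports stmt-ResolutionOfSingularities-16155 (helper, S3-N2 negative).
-/

-- every declaration of this summit lives under `Summit.ResolutionOfSingularities.ResolutionOfSingularities`
-- (summit = problem), which the duplicate-namespace linter flags; house convention (cf. the Target file).
set_option linter.dupNamespace false

noncomputable section

open MvPolynomial Finset CategoryTheory AlgebraicGeometry Opposite TopologicalSpace IsLocalRing
open AlgebraicGeometry.Scheme.IdealSheafData (ofIdealTop vanishingIdeal)

namespace Summit.ResolutionOfSingularities.ResolutionOfSingularities.Theorems.PIDim4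

open Literature.AlgebraicGeometry.Resolution
open Literature.AlgebraicGeometry.Resolution.AffinePointBlowup (P A γ coord Wtop ξ)
open Literature.AlgebraicGeometry.Hironaka2017.SpecOrders
open Literature.RingTheory.MvPolynomial (X_mem_span_X_image_iff)

namespace ChartDictionary

variable {K : Type} [Field K] {T : Finset (Fin 4)} {j m : Fin 4} {b : K}

/-! ## §1 The two hyperplane sheaves are different -/

/-- `x_m + b·x_j ∉ (x_j)` for `m ≠ j`. -/
theorem X_add_C_mul_X_not_mem_span (hmj : m ≠ j) (b : K) :
    (X m.succ + C b * X j.succ : A 4 K) ∉ Ideal.span (X '' ({j.succ} : Set (Fin (4 + 1)))) := by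
  classical
  intro hmem
  rw [mem_ideal_span_X_image] at hmem
  have hsupp : Finsupp.single m.succ 1 ∈ (X m.succ + C b * X j.succ : A 4 K).support := by
    rw [MvPolynomial.mem_support_iff, coeff_add, coeff_X_same, coeff_C_mul, coeff_X, if_neg, mul_zero, add_zero]
    · exact one_ne_zero
    · intro e
      exact hmj (Fin.succ_inj.mp (Finsupp.single_left_injective one_ne_zero e)).symm
  obtain ⟨i, hi, hne⟩ := hmem _ hsupp
  rw [Set.mem_singleton_iff] at hi
  subst hi
  exact hne (Finsupp.single_eq_of_ne (fun e => hmj (Fin.succ_inj.mp e).symm))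

/-- The ideal sheaves `x_j·𝒪` and `(x_m + b x_j)·𝒪` on `𝔸⁵` are different (`m ≠ j`): the generic point of `{x_j = 0}` lies
in the support of the first and not of the second. -/
theorem ofIdealTop_X_ne_ofIdealTop_shear (hmj : m ≠ j) (b : K) :
    ofIdealTop (Ideal.span {(γ 4 K).symm (X j.succ)}) ≠
      ofIdealTop (Ideal.span {(γ 4 K).symm (X m.succ + C b * X j.succ)}) := by
  intro e
  let Q : P 4 K := ⟨AffineCoordBlowup.IΛ 4 K ({j.succ} : Set (Fin (4 + 1))), AffineCoordBlowup.isPrime_IΛ 4 K _⟩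
  have h1 : Q ∈ (ofIdealTop (Ideal.span {(γ 4 K).symm (X j.succ)})).support := by
    rw [ofIdealTop_span_γ_symm_eq_shf, mem_support_shf_iff, Ideal.span_singleton_le_iff_mem]
    exact Ideal.subset_span ⟨j.succ, Set.mem_singleton _, rfl⟩
  rw [e, ofIdealTop_span_γ_symm_eq_shf, mem_support_shf_iff, Ideal.span_singleton_le_iff_mem] at h1
  exact X_add_C_mul_X_not_mem_span hmj b h1

/-! ## §2 The obstruction on the model `𝔸⁵` -/

/-- Contraction from the local ring at `𝔭 ⊇ (z, x_T)`: `(z, x_T)·𝒪_𝔭 ∩ K[z, x] = (z, x_T)`. -/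
theorem mem_IΛ_of_algebraMap_mem_map {Λ : Set (Fin (4 + 1))} (P : P 4 K) (hle : AffineCoordBlowup.IΛ 4 K Λ ≤ P.asIdeal)
    {f : A 4 K} (hf : algebraMap (A 4 K) (St (A 4 K) P) f ∈
      (AffineCoordBlowup.IΛ 4 K Λ).map (algebraMap (A 4 K) (St (A 4 K) P))) :
    f ∈ AffineCoordBlowup.IΛ 4 K Λ := by
  have hdisj : Disjoint (P.asIdeal.primeCompl : Set (A 4 K)) (AffineCoordBlowup.IΛ 4 K Λ : Set (A 4 K)) := by
    rw [Set.disjoint_left]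
    intro g hg hgI
    exact hg (hle hgI)
  have hcomap := IsLocalization.under_map_of_isPrime_disjoint (M := P.asIdeal.primeCompl) (S := St (A 4 K) P)
    (AffineCoordBlowup.isPrime_IΛ 4 K Λ) hdisj
  have hfin : f ∈ ((AffineCoordBlowup.IΛ 4 K Λ).map (algebraMap (A 4 K) (St (A 4 K) P))).under (A 4 K) :=
    Ideal.mem_comap.mpr hf
  rwa [hcomap] at hfin

/-- **THE SNC OBSTRUCTION ON THE MODEL.** For `m ∈ T`, `j ∉ T`, `b ≠ 0` and any list `E` of ideal sheaves on `𝔸⁵_K` containing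
`x_j·𝒪` and `(x_m + b·x_j)·𝒪`: the coordinate subspace `V(z, x_T)` does NOT have simple normal crossings with `E`. -/
theorem not_hasSNCWith_of_shear_hyperplanes (hmT : m ∈ T) (hjT : j ∉ T) (hb : b ≠ 0) {E : List (P 4 K).IdealSheafData}
    (hDj : ofIdealTop (Ideal.span {(γ 4 K).symm (X j.succ)}) ∈ E)
    (hDm : ofIdealTop (Ideal.span {(γ 4 K).symm (X m.succ + C b * X j.succ)}) ∈ E) :
    ¬ HasSNCWith E (AffineCoordBlowup.𝓘Λ 4 K (insert 0 (Fin.succ '' (T : Set (Fin 4))))) := by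
  classical
  intro h
  have hmj : m ≠ j := fun e => hjT (e ▸ hmT)
  set Λ : Set (Fin (4 + 1)) := insert 0 (Fin.succ '' (T : Set (Fin 4))) with hΛ
  set Dj := ofIdealTop (Ideal.span {(γ 4 K).symm (X j.succ)}) with hDjdef
  set Dm := ofIdealTop (Ideal.span {(γ 4 K).symm (X m.succ + C b * X j.succ)}) with hDmdef
  have hDj' : Dj = shf (A 4 K) (Ideal.span {(X j.succ : A 4 K)}) := ofIdealTop_span_γ_symm_eq_shf _
  have hDm' : Dm = shf (A 4 K) (Ideal.span {(X m.succ + C b * X j.succ : A 4 K)}) := ofIdealTop_span_γ_symm_eq_shf _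
  have hC' : AffineCoordBlowup.𝓘Λ 4 K Λ = shf (A 4 K) (AffineCoordBlowup.IΛ 4 K Λ) :=
    Cruxes.EquisingularLiftNat.Sections.ND.𝓘Λ_eq_idealSheafOf 4 K Λ
  -- the generic point of `V(z, x_T, x_j)`
  let Pt : P 4 K := ⟨AffineCoordBlowup.IΛ 4 K (insert 0 (Fin.succ '' ((insert j T : Finset (Fin 4)) : Set (Fin 4)))),
    AffineCoordBlowup.isPrime_IΛ 4 K _⟩
  have hle : AffineCoordBlowup.IΛ 4 K Λ ≤ Pt.asIdeal := by
    refine Ideal.span_mono (Set.image_mono (Set.insert_subset_insert (Set.image_mono ?_)))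
    rw [Finset.coe_insert]
    exact Set.subset_insert _ _
  have hXj : (X j.succ : A 4 K) ∈ Pt.asIdeal :=
    Ideal.subset_span ⟨j.succ, Set.mem_insert_of_mem _ ⟨j, by rw [Finset.coe_insert]; exact Set.mem_insert _ _, rfl⟩, rfl⟩
  have hXm : (X m.succ : A 4 K) ∈ AffineCoordBlowup.IΛ 4 K Λ :=
    Ideal.subset_span ⟨m.succ, Set.mem_insert_of_mem _ ⟨m, Finset.mem_coe.mpr hmT, rfl⟩, rfl⟩
  have hPC : Pt ∈ (AffineCoordBlowup.𝓘Λ 4 K Λ).support := by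
    rw [hC', mem_support_shf_iff]; exact hle
  have hPDj : Pt ∈ Dj.support := by
    rw [hDj', mem_support_shf_iff, Ideal.span_singleton_le_iff_mem]; exact hXj
  have hPDm : Pt ∈ Dm.support := by
    rw [hDm', mem_support_shf_iff, Ideal.span_singleton_le_iff_mem]
    exact Ideal.add_mem _ (hle hXm) (Ideal.mul_mem_left _ _ hXj)
  -- the snc data at that point
  obtain ⟨hreg, u, hu, ⟨ι, hιinj, hι⟩, hC⟩ := h Pt
  haveI := hreg
  obtain ⟨S, hS⟩ := hC hPC
  set φ := algebraMap (A 4 K) (St (A 4 K) Pt) with hφ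
  set a := ι ⟨Dj, hDj, hPDj⟩ with ha
  set c := ι ⟨Dm, hDm, hPDm⟩ with hc
  have hac : a ≠ c := fun e => by
    have h1 := congrArg Subtype.val (hιinj e)
    exact ofIdealTop_X_ne_ofIdealTop_shear (K := K) hmj b h1
  have h1 : Ideal.span {φ (X j.succ)} = Ideal.span {u a} := by
    rw [ha, ← hι ⟨Dj, hDj, hPDj⟩]
    change _ = stalkIdeal Dj Pt
    rw [hDj', stalkIdeal_shf, Ideal.map_span, Set.image_singleton]
  have h2 : Ideal.span {φ (X m.succ + C b * X j.succ)} = Ideal.span {u c} := by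
    rw [hc, ← hι ⟨Dm, hDm, hPDm⟩]
    change _ = stalkIdeal Dm Pt
    rw [hDm', stalkIdeal_shf, Ideal.map_span, Set.image_singleton]
  have h3 : (AffineCoordBlowup.IΛ 4 K Λ).map φ = Ideal.span (u '' S) := by
    rw [← hS, hC', stalkIdeal_shf]
  -- `φ x_m ∈ (z, x_T)·𝒪` and the germ of `x_m + b x_j` is `w · u_c`
  have hxm : φ (X m.succ) ∈ (AffineCoordBlowup.IΛ 4 K Λ).map φ := Ideal.mem_map_of_mem _ hXm
  -- Step 1: `c ∉ S` — otherwise `x_j ∈ (z, x_T)`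
  have hcS : c ∉ S := by
    intro hcS
    have huc : u c ∈ (AffineCoordBlowup.IΛ 4 K Λ).map φ := by
      rw [h3]; exact Ideal.subset_span ⟨c, hcS, rfl⟩
    have hgen : φ (X m.succ + C b * X j.succ) ∈ (AffineCoordBlowup.IΛ 4 K Λ).map φ := by
      have h4 : φ (X m.succ + C b * X j.succ) ∈ Ideal.span {u c} := by rw [← h2]; exact Ideal.mem_span_singleton_self _
      obtain ⟨w, hw⟩ := Ideal.mem_span_singleton'.mp h4
      rw [← hw]
      exact Ideal.mul_mem_left _ _ huc
    have hxj : φ (X j.succ) ∈ (AffineCoordBlowup.IΛ 4 K Λ).map φ := by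
      have h4 := Ideal.sub_mem _ hgen hxm
      rw [map_add, add_sub_cancel_left, map_mul] at h4
      have h5 := Ideal.mul_mem_left _ (φ (C b⁻¹)) h4
      rwa [← mul_assoc, ← map_mul, ← C_mul, inv_mul_cancel₀ hb, C_1, map_one, one_mul] at h5
    exact X_succ_not_mem_IΛ hjT (mem_IΛ_of_algebraMap_mem_map Pt hle hxj)
  -- Step 2: `u_c ∈ (u_i : i ∈ insert a S)` — contradicting minimality of the basis `u` of `𝔪`
  have hca : c ∉ insert a S := by
    rintro (e | e)
    · exact hac e.symm
    · exact hcS e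
  refine not_mem_span_image_of_not_mem rfl u hu hca ?_
  have h4 : u c ∈ Ideal.span {φ (X m.succ + C b * X j.succ)} := by rw [h2]; exact Ideal.mem_span_singleton_self _
  obtain ⟨w, hw⟩ := Ideal.mem_span_singleton'.mp h4
  rw [← hw, map_add, map_mul, mul_add]
  have hsub : Ideal.span (u '' S) ≤ Ideal.span (u '' insert a S) := Ideal.span_mono (Set.image_mono (Set.subset_insert _ _))
  refine Ideal.add_mem _ (Ideal.mul_mem_left _ _ (hsub (h3 ▸ hxm))) (Ideal.mul_mem_left _ _ (Ideal.mul_mem_left _ _ ?_))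
  have h5 : φ (X j.succ) ∈ Ideal.span {u a} := by rw [← h1]; exact Ideal.mem_span_singleton_self _
  exact (Ideal.span_mono (Set.singleton_subset_iff.mpr (Set.mem_image_of_mem u (Set.mem_insert a S)))) h5

/-! ## §3 The obstruction on any scheme carrying such chart readings -/

/-- **THE SNC OBSTRUCTION, GLOBAL FORM.** Let `φ : 𝔸⁵_K → W` be an open immersion (a re-centred chart), `Zc` an ideal sheaf on
`W` reading `𝓘Λ_T` on `φ`, and `E` a boundary on `W` two of whose members read `x_j·𝒪` and `(x_m + b·x_j)·𝒪` on `φ`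
(`m ∈ T`, `j ∉ T`, `b ≠ 0`). Then `Zc` does NOT have simple normal crossings with `E`: it is not an admissible BGMW centre. -/
theorem not_hasSNCWith_of_chart_readings {W : Scheme.{0}} [IsLocallyNoetherian W] (φ : P 4 K ⟶ W) [IsOpenImmersion φ]
    (hmT : m ∈ T) (hjT : j ∉ T) (hb : b ≠ 0) {E : List W.IdealSheafData} {Zc Dj Dm : W.IdealSheafData}
    (hDjE : Dj ∈ E) (hDmE : Dm ∈ E)
    (hZc : Zc.comap φ = AffineCoordBlowup.𝓘Λ 4 K (insert 0 (Fin.succ '' (T : Set (Fin 4)))))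
    (hDj : Dj.comap φ = ofIdealTop (Ideal.span {(γ 4 K).symm (X j.succ)}))
    (hDm : Dm.comap φ = ofIdealTop (Ideal.span {(γ 4 K).symm (X m.succ + C b * X j.succ)})) :
    ¬ HasSNCWith E Zc := by
  intro h
  have h' := h.comap_of_isOpenImmersion φ
  rw [hZc] at h'
  refine not_hasSNCWith_of_shear_hyperplanes hmT hjT hb ?_ ?_ h'
  · rw [← hDj]; exact List.mem_map_of_mem hDjE
  · rw [← hDm]; exact List.mem_map_of_mem hDmE

/-! ## §4 The twin obstruction: two sheared old members (appended, typ-2 g5) -/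

/-- `x_m + b·x_j ∉ (xᵢ : i ∈ U)` whenever `m ∉ U` (and `m ≠ j`). -/
theorem X_add_C_mul_X_not_mem_span_of_not_mem {U : Set (Fin (4 + 1))} (hmU : m.succ ∉ U) (hmj : m ≠ j) (b : K) :
    (X m.succ + C b * X j.succ : A 4 K) ∉ Ideal.span (X '' U) := by
  classical
  intro hmem
  rw [mem_ideal_span_X_image] at hmem
  have hsupp : Finsupp.single m.succ 1 ∈ (X m.succ + C b * X j.succ : A 4 K).support := by
    rw [MvPolynomial.mem_support_iff, coeff_add, coeff_X_same, coeff_C_mul, coeff_X, if_neg, mul_zero, add_zero]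
    · exact one_ne_zero
    · intro e
      exact hmj (Fin.succ_inj.mp (Finsupp.single_left_injective one_ne_zero e)).symm
  obtain ⟨i, hi, hne⟩ := hmem _ hsupp
  refine hne (Finsupp.single_eq_of_ne ?_)
  rintro rfl
  exact hmU hi

/-- Two different sheared hyperplane sheaves (`m ≠ m'`, both `≠ j`). -/
theorem ofIdealTop_shear_ne_ofIdealTop_shear {m' : Fin 4} (hmm' : m ≠ m') (hmj : m ≠ j) (b b' : K) :
    ofIdealTop (Ideal.span {(γ 4 K).symm (X m.succ + C b * X j.succ)}) ≠
      ofIdealTop (Ideal.span {(γ 4 K).symm (X m'.succ + C b' * X j.succ)}) := by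
  intro e
  -- the generic point of `{x_{m'} = x_j = 0}` lies on the second and not on the first
  let Q : P 4 K := ⟨AffineCoordBlowup.IΛ 4 K ({m'.succ, j.succ} : Set (Fin (4 + 1))), AffineCoordBlowup.isPrime_IΛ 4 K _⟩
  have h1 : Q ∈ (ofIdealTop (Ideal.span {(γ 4 K).symm (X m'.succ + C b' * X j.succ)})).support := by
    rw [ofIdealTop_span_γ_symm_eq_shf, mem_support_shf_iff, Ideal.span_singleton_le_iff_mem]
    exact Ideal.add_mem _ (Ideal.subset_span ⟨m'.succ, Set.mem_insert _ _, rfl⟩)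
      (Ideal.mul_mem_left _ _ (Ideal.subset_span ⟨j.succ, Set.mem_insert_of_mem _ (Set.mem_singleton _), rfl⟩))
  rw [← e, ofIdealTop_span_γ_symm_eq_shf, mem_support_shf_iff, Ideal.span_singleton_le_iff_mem] at h1
  refine X_add_C_mul_X_not_mem_span_of_not_mem (U := ({m'.succ, j.succ} : Set (Fin (4 + 1)))) ?_ hmj b h1
  rintro (h | h)
  · exact hmm' (Fin.succ_inj.mp h)
  · exact hmj (Fin.succ_inj.mp h)

/-- In the local ring at `𝔭 ⊇ (z, x_T) ∋ x_m`: if the germ of `x_m + b·x_j` (`b ≠ 0`) lies in `(z, x_T)·𝒪_𝔭`, so does the germ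
of `x_j`. -/
theorem algebraMap_X_mem_map_of_shear_mem {Λ : Set (Fin (4 + 1))} (P : P 4 K) (hmΛ : m.succ ∈ Λ) (hb : b ≠ 0)
    (h : algebraMap (A 4 K) (St (A 4 K) P) (X m.succ + C b * X j.succ) ∈
      (AffineCoordBlowup.IΛ 4 K Λ).map (algebraMap (A 4 K) (St (A 4 K) P))) :
    algebraMap (A 4 K) (St (A 4 K) P) (X j.succ) ∈
      (AffineCoordBlowup.IΛ 4 K Λ).map (algebraMap (A 4 K) (St (A 4 K) P)) := by
  set φ := algebraMap (A 4 K) (St (A 4 K) P) with hφ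
  have hxm : φ (X m.succ) ∈ (AffineCoordBlowup.IΛ 4 K Λ).map φ :=
    Ideal.mem_map_of_mem _ (Ideal.subset_span ⟨m.succ, hmΛ, rfl⟩)
  have h4 := Ideal.sub_mem _ h hxm
  rw [map_add, add_sub_cancel_left, map_mul] at h4
  have h5 := Ideal.mul_mem_left _ (φ (C b⁻¹)) h4
  rwa [← mul_assoc, ← map_mul, ← C_mul, inv_mul_cancel₀ hb, C_1, map_one, one_mul] at h5

/-- **THE TWIN OBSTRUCTION ON THE MODEL.** For `m ≠ m'` in `T`, `j ∉ T`, `b, b' ≠ 0` and any list `E` containing the two SHEARED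
hyperplane sheaves `(x_m + b·x_j)·𝒪` and `(x_{m'} + b'·x_j)·𝒪`: `V(z, x_T)` does NOT have simple normal crossings with `E` — two old
members translated away at `b` obstruct as well, without `{x_j = 0}`. (At the generic point of `V(z, x_T, x_j)`: `c, c' ∉ S` by
contraction, and `b'·(x_m + b x_j) − b·(x_{m'} + b' x_j) ∈ (z, x_T)` puts `u_c` in `(u_S) + (u_{c'})`.) -/
theorem not_hasSNCWith_of_two_shear_hyperplanes {m' : Fin 4} {b' : K} (hmT : m ∈ T) (hm'T : m' ∈ T) (hmm' : m ≠ m')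
    (hjT : j ∉ T) (hb : b ≠ 0) (hb' : b' ≠ 0) {E : List (P 4 K).IdealSheafData}
    (hDm : ofIdealTop (Ideal.span {(γ 4 K).symm (X m.succ + C b * X j.succ)}) ∈ E)
    (hDm' : ofIdealTop (Ideal.span {(γ 4 K).symm (X m'.succ + C b' * X j.succ)}) ∈ E) :
    ¬ HasSNCWith E (AffineCoordBlowup.𝓘Λ 4 K (insert 0 (Fin.succ '' (T : Set (Fin 4))))) := by
  classical
  intro h
  have hmj : m ≠ j := fun e => hjT (e ▸ hmT)
  have hm'j : m' ≠ j := fun e => hjT (e ▸ hm'T)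
  set Λ : Set (Fin (4 + 1)) := insert 0 (Fin.succ '' (T : Set (Fin 4))) with hΛ
  set Dm := ofIdealTop (Ideal.span {(γ 4 K).symm (X m.succ + C b * X j.succ)}) with hDmdef
  set Dm' := ofIdealTop (Ideal.span {(γ 4 K).symm (X m'.succ + C b' * X j.succ)}) with hDm'def
  have hDm1 : Dm = shf (A 4 K) (Ideal.span {(X m.succ + C b * X j.succ : A 4 K)}) := ofIdealTop_span_γ_symm_eq_shf _
  have hDm'1 : Dm' = shf (A 4 K) (Ideal.span {(X m'.succ + C b' * X j.succ : A 4 K)}) := ofIdealTop_span_γ_symm_eq_shf _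
  have hC' : AffineCoordBlowup.𝓘Λ 4 K Λ = shf (A 4 K) (AffineCoordBlowup.IΛ 4 K Λ) :=
    Cruxes.EquisingularLiftNat.Sections.ND.𝓘Λ_eq_idealSheafOf 4 K Λ
  have hmΛ : m.succ ∈ Λ := Set.mem_insert_of_mem _ ⟨m, Finset.mem_coe.mpr hmT, rfl⟩
  have hm'Λ : m'.succ ∈ Λ := Set.mem_insert_of_mem _ ⟨m', Finset.mem_coe.mpr hm'T, rfl⟩
  -- the generic point of `V(z, x_T, x_j)`
  let Pt : P 4 K := ⟨AffineCoordBlowup.IΛ 4 K (insert 0 (Fin.succ '' ((insert j T : Finset (Fin 4)) : Set (Fin 4)))),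
    AffineCoordBlowup.isPrime_IΛ 4 K _⟩
  have hle : AffineCoordBlowup.IΛ 4 K Λ ≤ Pt.asIdeal := by
    refine Ideal.span_mono (Set.image_mono (Set.insert_subset_insert (Set.image_mono ?_)))
    rw [Finset.coe_insert]
    exact Set.subset_insert _ _
  have hXj : (X j.succ : A 4 K) ∈ Pt.asIdeal :=
    Ideal.subset_span ⟨j.succ, Set.mem_insert_of_mem _ ⟨j, by rw [Finset.coe_insert]; exact Set.mem_insert _ _, rfl⟩, rfl⟩
  have hXm : (X m.succ : A 4 K) ∈ AffineCoordBlowup.IΛ 4 K Λ := Ideal.subset_span ⟨m.succ, hmΛ, rfl⟩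
  have hXm' : (X m'.succ : A 4 K) ∈ AffineCoordBlowup.IΛ 4 K Λ := Ideal.subset_span ⟨m'.succ, hm'Λ, rfl⟩
  have hPC : Pt ∈ (AffineCoordBlowup.𝓘Λ 4 K Λ).support := by
    rw [hC', mem_support_shf_iff]; exact hle
  have hPDm : Pt ∈ Dm.support := by
    rw [hDm1, mem_support_shf_iff, Ideal.span_singleton_le_iff_mem]
    exact Ideal.add_mem _ (hle hXm) (Ideal.mul_mem_left _ _ hXj)
  have hPDm' : Pt ∈ Dm'.support := by
    rw [hDm'1, mem_support_shf_iff, Ideal.span_singleton_le_iff_mem]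
    exact Ideal.add_mem _ (hle hXm') (Ideal.mul_mem_left _ _ hXj)
  -- the snc data at that point
  obtain ⟨hreg, u, hu, ⟨ι, hιinj, hι⟩, hC⟩ := h Pt
  haveI := hreg
  obtain ⟨S, hS⟩ := hC hPC
  set φ := algebraMap (A 4 K) (St (A 4 K) Pt) with hφ
  set c := ι ⟨Dm, hDm, hPDm⟩ with hc
  set c' := ι ⟨Dm', hDm', hPDm'⟩ with hc'
  have hcc' : c ≠ c' := fun e => by
    have h1 := congrArg Subtype.val (hιinj e)
    exact ofIdealTop_shear_ne_ofIdealTop_shear (K := K) hmm' hmj b b' h1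
  have h2 : Ideal.span {φ (X m.succ + C b * X j.succ)} = Ideal.span {u c} := by
    rw [hc, ← hι ⟨Dm, hDm, hPDm⟩]
    change _ = stalkIdeal Dm Pt
    rw [hDm1, stalkIdeal_shf, Ideal.map_span, Set.image_singleton]
  have h2' : Ideal.span {φ (X m'.succ + C b' * X j.succ)} = Ideal.span {u c'} := by
    rw [hc', ← hι ⟨Dm', hDm', hPDm'⟩]
    change _ = stalkIdeal Dm' Pt
    rw [hDm'1, stalkIdeal_shf, Ideal.map_span, Set.image_singleton]
  have h3 : (AffineCoordBlowup.IΛ 4 K Λ).map φ = Ideal.span (u '' S) := by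
    rw [← hS, hC', stalkIdeal_shf]
  have hxm : φ (X m.succ) ∈ (AffineCoordBlowup.IΛ 4 K Λ).map φ := Ideal.mem_map_of_mem _ hXm
  have hxm' : φ (X m'.succ) ∈ (AffineCoordBlowup.IΛ 4 K Λ).map φ := Ideal.mem_map_of_mem _ hXm'
  -- Step 1: `c ∉ S`
  have hcS : c ∉ S := by
    intro hcS
    have huc : u c ∈ (AffineCoordBlowup.IΛ 4 K Λ).map φ := by
      rw [h3]; exact Ideal.subset_span ⟨c, hcS, rfl⟩
    have hgen : φ (X m.succ + C b * X j.succ) ∈ (AffineCoordBlowup.IΛ 4 K Λ).map φ := by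
      have h4 : φ (X m.succ + C b * X j.succ) ∈ Ideal.span {u c} := by rw [← h2]; exact Ideal.mem_span_singleton_self _
      obtain ⟨w, hw⟩ := Ideal.mem_span_singleton'.mp h4
      rw [← hw]
      exact Ideal.mul_mem_left _ _ huc
    exact X_succ_not_mem_IΛ hjT (mem_IΛ_of_algebraMap_mem_map Pt hle (algebraMap_X_mem_map_of_shear_mem Pt hmΛ hb hgen))
  -- Step 2: `u_c ∈ (u_i : i ∈ insert c' S)`
  have hcc'S : c ∉ insert c' S := by
    rintro (e | e)
    · exact hcc' e
    · exact hcS e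
  refine not_mem_span_image_of_not_mem rfl u hu hcc'S ?_
  have hsub : Ideal.span (u '' S) ≤ Ideal.span (u '' insert c' S) := Ideal.span_mono (Set.image_mono (Set.subset_insert _ _))
  -- the germ of `x_j` lies in `(u_S) + (u_{c'})`
  have hxj : φ (X j.succ) ∈ Ideal.span (u '' insert c' S) := by
    have h4 : φ (X m'.succ + C b' * X j.succ) ∈ Ideal.span {u c'} := by
      rw [← h2']; exact Ideal.mem_span_singleton_self _
    have h5 : φ (X m'.succ + C b' * X j.succ) ∈ Ideal.span (u '' insert c' S) :=
      (Ideal.span_mono (Set.singleton_subset_iff.mpr (Set.mem_image_of_mem u (Set.mem_insert c' S)))) h4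
    have h6 := Ideal.sub_mem _ h5 (hsub (h3 ▸ hxm'))
    rw [map_add, add_sub_cancel_left, map_mul] at h6
    have h7 := Ideal.mul_mem_left _ (φ (C b'⁻¹)) h6
    rwa [← mul_assoc, ← map_mul, ← C_mul, inv_mul_cancel₀ hb', C_1, map_one, one_mul] at h7
  have h4 : u c ∈ Ideal.span {φ (X m.succ + C b * X j.succ)} := by rw [h2]; exact Ideal.mem_span_singleton_self _
  obtain ⟨w, hw⟩ := Ideal.mem_span_singleton'.mp h4
  rw [← hw, map_add, map_mul, mul_add]
  exact Ideal.add_mem _ (Ideal.mul_mem_left _ _ (hsub (h3 ▸ hxm))) (Ideal.mul_mem_left _ _ (Ideal.mul_mem_left _ _ hxj))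

/-- **THE TWIN OBSTRUCTION, GLOBAL FORM**: two boundary members reading `(x_m + b x_j)·𝒪` and `(x_{m'} + b' x_j)·𝒪` on an affine
chart where the centre reads `𝓘Λ_T` (`m ≠ m' ∈ T`, `j ∉ T`, `b, b' ≠ 0`) make the centre non-admissible. -/
theorem not_hasSNCWith_of_chart_readings_two_shear {W : Scheme.{0}} [IsLocallyNoetherian W] (φ : P 4 K ⟶ W)
    [IsOpenImmersion φ] {m' : Fin 4} {b' : K} (hmT : m ∈ T) (hm'T : m' ∈ T) (hmm' : m ≠ m') (hjT : j ∉ T) (hb : b ≠ 0)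
    (hb' : b' ≠ 0) {E : List W.IdealSheafData} {Zc Dm Dm' : W.IdealSheafData} (hDmE : Dm ∈ E) (hDm'E : Dm' ∈ E)
    (hZc : Zc.comap φ = AffineCoordBlowup.𝓘Λ 4 K (insert 0 (Fin.succ '' (T : Set (Fin 4)))))
    (hDm : Dm.comap φ = ofIdealTop (Ideal.span {(γ 4 K).symm (X m.succ + C b * X j.succ)}))
    (hDm' : Dm'.comap φ = ofIdealTop (Ideal.span {(γ 4 K).symm (X m'.succ + C b' * X j.succ)})) :
    ¬ HasSNCWith E Zc := by
  intro h
  have h' := h.comap_of_isOpenImmersion φ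
  rw [hZc] at h'
  refine not_hasSNCWith_of_two_shear_hyperplanes hmT hm'T hmm' hjT hb hb' ?_ ?_ h'
  · rw [← hDm]; exact List.mem_map_of_mem hDmE
  · rw [← hDm']; exact List.mem_map_of_mem hDm'E

end ChartDictionary

end Summit.ResolutionOfSingularities.ResolutionOfSingularities.Theorems.PIDim4

end
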